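import Summits.ResolutionOfSingularities.ResolutionOfSingularities.Theorems.EquisingularLiftEquisingularLiftWittRing
import Summits.ResolutionOfSingularities.ResolutionOfSingularities.Theorems.EquisingularLiftEquisingularLiftProjectiveAmbientSmoothProper
import Summits.ResolutionOfSingularities.ResolutionOfSingularities.Theorems.EquisingularLiftEquisingularLiftProjectiveAmbientFibre
import Summits.ResolutionOfSingularities.ResolutionOfSingularities.Theses.EquisingularLift
import Literature.AlgebraicGeometry.Resolution.ResolutionGlue
import HarnessLib

/-!
# `EquisingularLift` — CALIBRATION: the crux holds for REGULAR hypersurfaces (trivial chain)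

Crux `stmt-ResolutionOfSingularities-15660` = `Theses.EquisingularLift.EquisingularLift` (EL). This file records, in the
kernel, that EL's conclusion (all seven conjuncts: smooth proper ambient over a characteristic-0 DVR, `Y` in the special
fibre with `V(Y) ≅ H`, the recursor-encoded chain, irreducible special fibre, regular reduced strict transform) is
instantiable as soon as `H` itself is regular: `O := 𝕎(k)` (`StrataSplit.stub_wittRing`), `P := ℙⁿ_O`
(`stub_projectiveAmbientSmoothProper`, `stub_projectiveAmbientFibre`), the EMPTY chain `(P, 𝟙, Y)`, and regularity
transported along `V(Y) ≅ H`. Together with `Theorems.EquisingularLift.resolutionOverAlgClosed_of_equisingularLift`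
(EL ⟹ resolution over every algebraically closed field of characteristic `p`) this brackets the crux: its entire content
is the SINGULAR case, i.e. liftable embedded resolution (refuters' ATTACK.md / Disproof.lean §0–1, now kernel-side).
Calibration only — not progress toward the singular case.
-/

set_option linter.dupNamespace false -- mandated namespace `Summit.<Summit>.<Problem>` of this single-conjunct summit

noncomputable section

open CategoryTheory AlgebraicGeometry TopologicalSpace Topology
open Literature.AlgebraicGeometry.Resolution
open Summit.ResolutionOfSingularities.ResolutionOfSingularities.Cruxes.EquisingularLift.StrataSplit

namespace Summit.ResolutionOfSingularities.ResolutionOfSingularities.Theorems.EquisingularLift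

/-- **EL for regular hypersurfaces (calibration).** Under the hypotheses of `EquisingularLift` and `Scheme.IsRegular H`,
the conclusion of `EquisingularLift` holds with `O = 𝕎(k)`, `P = P' = ℙⁿ_O`, `σ = 𝟙`, `S' = Y` (no blow-up).
[folklore] -/
theorem equisingularLift_of_isRegular : ∀ p : ℕ, p.Prime → ∀ (k : Type) [Field k] [CharP k p] [IsAlgClosed k] (n : ℕ) (H : AlgebraicGeometry.Scheme.{0}) (ι : H ⟶ (Literature.AlgebraicGeometry.Motives.projectiveSpace n k).left), AlgebraicGeometry.IsClosedImmersion ι → AlgebraicGeometry.IsIntegral H → (∀ y : (Literature.AlgebraicGeometry.Motives.projectiveSpace n k).left, ∃ U : (Literature.AlgebraicGeometry.Motives.projectiveSpace n k).left.affineOpens, y ∈ (U : (Literature.AlgebraicGeometry.Motives.projectiveSpace n k).left.Opens) ∧ (ι.ker.ideal U).IsPrincipal) → Literature.AlgebraicGeometry.Resolution.Scheme.IsRegular H → ∃ (O : Type) (_ : CommRing O) (_ : IsDomain O) (_ : IsDiscreteValuationRing O) (_ : CharZero O) (P P' : AlgebraicGeometry.Scheme.{0}) (q : P ⟶ AlgebraicGeometry.Spec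 (.of O)) (Y : TopologicalSpace.Closeds P) (σ : P' ⟶ P) (S' : Set P'), AlgebraicGeometry.Smooth q ∧ AlgebraicGeometry.IsProper q ∧ (Y : Set P) ⊆ q ⁻¹' {IsLocalRing.closedPoint O} ∧ Nonempty ((AlgebraicGeometry.Scheme.IdealSheafData.vanishingIdeal Y).subscheme ≅ H) ∧ (∀ Q : (∀ X' : AlgebraicGeometry.Scheme.{0}, (X' ⟶ P) → Set X' → Prop), Q P (CategoryTheory.CategoryStruct.id P) (Y : Set P) → (∀ (X' X'' : AlgebraicGeometry.Scheme.{0}) (σ' : X' ⟶ P) (Y' : Set X') (C : X'.IdealSheafData) (τ : X'' ⟶ X'), Q X' σ' Y' → Literature.AlgebraicGeometry.Resolution.IsBlowup τ C → Literature.AlgebraicGeometry.Resolution.Scheme.IsRegular C.subscheme → σ' '' (C.support : Set X') ⊆ {x : P | ¬ IsGenericPoint x (Y : Set P)} → Q X'' (CategoryTheory.CategoryStruct.comp τ σ') (closure (τ ⁻¹' (Y' \ (C.support : Set X'))))) → Q P' σ S') ∧ IsIrreducible ((CategoryTheory.CategoryStruct.comp σ q) ⁻¹' {IsLocalRing.closedPoint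 O}) ∧ Literature.AlgebraicGeometry.Resolution.Scheme.IsRegular (AlgebraicGeometry.Scheme.IdealSheafData.vanishingIdeal (⟨closure S', isClosed_closure⟩ : TopologicalSpace.Closeds P')).subscheme := by
  intro p hp k _ _ _ n H ι hι hH _ hreg
  obtain ⟨O, i1, i2, i3, i4, i5, i6, π, hπ⟩ := stub_wittRing p hp k
  obtain ⟨hsm, hprop⟩ := stub_projectiveAmbientSmoothProper O n
  obtain ⟨Y, hY, ⟨e⟩, hirr⟩ := stub_projectiveAmbientFibre O k π hπ n H ι hι hH
  refine ⟨O, i1, i2, i3, i4, _, _, _, Y, CategoryStruct.id _, (Y : Set _), hsm, hprop, hY, ⟨e⟩,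
    fun Q h0 _ => h0, ?_, ?_⟩
  · rwa [Category.id_comp]
  · have hZ : (⟨closure (Y : Set _), isClosed_closure⟩ : TopologicalSpace.Closeds _) = Y :=
      TopologicalSpace.Closeds.ext Y.isClosed.closure_eq
    rw [hZ]
    exact Scheme.IsRegular.of_iso e.inv hreg

end Summit.ResolutionOfSingularities.ResolutionOfSingularities.Theorems.EquisingularLift

end
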